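import Summits.Parity.GeneralizedHardyLittlewood.Theorems.PrimeLevelFamEdgeMomentsBeyondDiagonalLayersFormReductionZero
import HarnessLib

/-!
# Route `PrimeLevelFamEdge`, crux K_A `MomentsBeyondDiagonal` (stmt-Parity-20007), line «petersson_layers» v4:
# the generic size of Pascadi's bracket on the print band (assembly step E5b, second reduction)

`…LayersClassLengths.bracket71_class_le` bounds the class bracket by three generic terms.  On the window of
`…LayersFormReductionZero` (`q ≥ 64`, `0 < Δ' ≤ 101/100`, `0 ≤ η ≤ 1/100`, `Y = ⌈q̂^{2+η}⌉`, `q̂^{11/10} < r`) the three scalars are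
at most `q̂^{−13/100}` (`x = q̂`, `q = 4π²x²`, `r > x^{11/10}`; exponent checks `6.06 + 2.01 = −0.13 + 6 + 2.2`,
`4.04 ≤ −0.13 + 4 + 1.1`, `0 ≤ −0.13 + 1.1`):
* `generic_scalar_one_le`: `x^{6Δ'}·Y·r/(qr)³ ≤ x^{−13/100}`;
* `generic_scalar_two_le`: `x^{4Δ'}·r/(qr)² ≤ x^{−13/100}`;
* `generic_scalar_three_le`: `1/r ≤ x^{−13/100}`;
* **`bracket71_generic_le`**: for class data `g, d₁, d₂, s₂, t₁ ≥ 1`,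
  `r t₁² x^{6Δ'} Y/(g²(d₁d₂)⁴s₂²(qr)³) + r t₁² x^{4Δ'}/(g(d₁d₂)²s₂²(qr)²) + g/r ≤ 3·t₁²·g·x^{−13/100}` —
  the saving `x^{−13/600}` after the sixth root against the Parseval deficit `x^{λ+η/2}` (census CENSUS-leafhand2-g2).
Remaining (census E5b): the sixth root, the class weights and the class/block sums; NOT done here.
Proof only (def-free helper); K_A NOT proved; nothing about Landau–Siegel zeros.
-/

noncomputable section

open scoped Real Nat
open Complex Finset Polynomial MeasureTheory
open Literature.NumberTheory.LFunctions

namespace Summit.Parity.GeneralizedHardyLittlewood.Theorems.MomentsBeyondDiagonal.Layers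

open Summit.Parity.GeneralizedHardyLittlewood.Theorems.PrimeLevelFamEdgeIdeaDeltas.PeterssonLayers

/-- `x^{6Δ'}·⌈x^{2+η}⌉·r ≤ x^{−13/100}·(qr)³` on the band, i.e. `x^{6Δ'}·Y·r/(qr)³ ≤ x^{−13/100}`. [folklore] -/
theorem generic_scalar_one_le {q : ℕ} [NeZero q] (h64 : 64 ≤ q) {Δ' η : ℝ} (hΔ' : Δ' ≤ 101 / 100)
    (hη0 : 0 ≤ η) (hη : η ≤ 1 / 100) {r : ℕ} (hr : KMV2000.qhat q ^ (11 / 10 : ℝ) < r) :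
    KMV2000.qhat q ^ (6 * Δ') * ((⌈KMV2000.qhat q ^ (2 + η)⌉₊ : ℕ) : ℝ) * r / ((q : ℝ) * r) ^ 3 ≤
      KMV2000.qhat q ^ (-(13 / 100 : ℝ)) := by
  have hqh1 : 1 < KMV2000.qhat q := one_lt_qhat h64
  have hqh0 : 0 < KMV2000.qhat q := zero_lt_one.trans hqh1
  set x : ℝ := KMV2000.qhat q with hx
  have hr0 : (0 : ℝ) < r := lt_trans (Real.rpow_pos_of_pos hqh0 _) hr
  have hq : (q : ℝ) = 4 * π ^ 2 * x ^ 2 := by rw [hx]; exact natCast_eq_four_pi_sq_mul_qhat_sq q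
  have hq0 : (0 : ℝ) < q := by rw [hq]; positivity
  have hY : ((⌈x ^ (2 + η)⌉₊ : ℕ) : ℝ) ≤ 2 * x ^ (201 / 100 : ℝ) :=
    (natCeil_le_two_mul (Real.one_le_rpow hqh1.le (by linarith))).trans
      (mul_le_mul_of_nonneg_left (Real.rpow_le_rpow_of_exponent_le hqh1.le (by linarith)) (by norm_num))
  have hx6 : x ^ (6 * Δ') ≤ x ^ (606 / 100 : ℝ) := Real.rpow_le_rpow_of_exponent_le hqh1.le (by linarith)
  rw [div_le_iff₀ (by positivity)]
  -- upper bound for the left side: `2 x^{807/100} r`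
  have hL : x ^ (6 * Δ') * ((⌈x ^ (2 + η)⌉₊ : ℕ) : ℝ) * r ≤ 2 * x ^ (807 / 100 : ℝ) * r := by
    calc x ^ (6 * Δ') * ((⌈x ^ (2 + η)⌉₊ : ℕ) : ℝ) * r ≤ x ^ (606 / 100 : ℝ) * (2 * x ^ (201 / 100 : ℝ)) * r :=
          mul_le_mul_of_nonneg_right (mul_le_mul hx6 hY (Nat.cast_nonneg _) (Real.rpow_nonneg hqh0.le _)) hr0.le
      _ = 2 * x ^ (807 / 100 : ℝ) * r := by
          rw [show (807 / 100 : ℝ) = 606 / 100 + 201 / 100 by norm_num, Real.rpow_add hqh0]; ring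
  -- lower bound for the right side: `(4π²)³ x^{807/100} r`
  have hr2 : x ^ (11 / 5 : ℝ) ≤ (r : ℝ) ^ 2 := by
    have h := pow_le_pow_left₀ (Real.rpow_nonneg hqh0.le _) hr.le 2
    rw [← Real.rpow_natCast, ← Real.rpow_mul hqh0.le] at h
    norm_num at h
    exact h
  have hR : (4 * π ^ 2) ^ 3 * x ^ (807 / 100 : ℝ) * r ≤ x ^ (-(13 / 100 : ℝ)) * ((q : ℝ) * r) ^ 3 := by
    have e : x ^ (-(13 / 100 : ℝ)) * ((q : ℝ) * r) ^ 3 =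
        (4 * π ^ 2) ^ 3 * (x ^ (-(13 / 100 : ℝ)) * x ^ (6 : ℝ)) * ((r : ℝ) ^ 2 * r) := by
      rw [hq, show (6 : ℝ) = ((6 : ℕ) : ℝ) by norm_num, Real.rpow_natCast]; ring
    rw [e]
    have e2 : (4 * π ^ 2) ^ 3 * x ^ (807 / 100 : ℝ) * r =
        (4 * π ^ 2) ^ 3 * (x ^ (-(13 / 100 : ℝ)) * x ^ (6 : ℝ)) * (x ^ (11 / 5 : ℝ) * r) := by
      rw [show (4 * π ^ 2) ^ 3 * (x ^ (-(13 / 100 : ℝ)) * x ^ (6 : ℝ)) * (x ^ (11 / 5 : ℝ) * r) =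
          (4 * π ^ 2) ^ 3 * (x ^ (-(13 / 100 : ℝ)) * x ^ (6 : ℝ) * x ^ (11 / 5 : ℝ)) * r by ring,
        ← Real.rpow_add hqh0, ← Real.rpow_add hqh0]
      norm_num
    rw [e2]
    exact mul_le_mul_of_nonneg_left (mul_le_mul_of_nonneg_right hr2 hr0.le) (by positivity)
  have hπ : (2 : ℝ) ≤ (4 * π ^ 2) ^ 3 := by
    have h1 : (1 : ℝ) ≤ 4 * π ^ 2 := by nlinarith [Real.pi_gt_three]
    have h2 : (2 : ℝ) ≤ 4 * π ^ 2 := by nlinarith [Real.pi_gt_three]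
    exact h2.trans (le_self_pow₀ h1 (by norm_num))
  calc x ^ (6 * Δ') * ((⌈x ^ (2 + η)⌉₊ : ℕ) : ℝ) * r ≤ 2 * x ^ (807 / 100 : ℝ) * r := hL
    _ ≤ (4 * π ^ 2) ^ 3 * x ^ (807 / 100 : ℝ) * r :=
        mul_le_mul_of_nonneg_right (mul_le_mul_of_nonneg_right hπ (Real.rpow_nonneg hqh0.le _)) hr0.le
    _ ≤ _ := hR

/-- `x^{4Δ'}·r/(qr)² ≤ x^{−13/100}` on the band. [folklore] -/
theorem generic_scalar_two_le {q : ℕ} [NeZero q] (h64 : 64 ≤ q) {Δ' : ℝ} (hΔ' : Δ' ≤ 101 / 100)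
    {r : ℕ} (hr : KMV2000.qhat q ^ (11 / 10 : ℝ) < r) :
    KMV2000.qhat q ^ (4 * Δ') * r / ((q : ℝ) * r) ^ 2 ≤ KMV2000.qhat q ^ (-(13 / 100 : ℝ)) := by
  have hqh1 : 1 < KMV2000.qhat q := one_lt_qhat h64
  have hqh0 : 0 < KMV2000.qhat q := zero_lt_one.trans hqh1
  set x : ℝ := KMV2000.qhat q with hx
  have hr0 : (0 : ℝ) < r := lt_trans (Real.rpow_pos_of_pos hqh0 _) hr
  have hq : (q : ℝ) = 4 * π ^ 2 * x ^ 2 := by rw [hx]; exact natCast_eq_four_pi_sq_mul_qhat_sq q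
  have hq0 : (0 : ℝ) < q := by rw [hq]; positivity
  have hx4 : x ^ (4 * Δ') ≤ x ^ (497 / 100 : ℝ) := Real.rpow_le_rpow_of_exponent_le hqh1.le (by linarith)
  rw [div_le_iff₀ (by positivity)]
  have e : x ^ (-(13 / 100 : ℝ)) * ((q : ℝ) * r) ^ 2 =
      (4 * π ^ 2) ^ 2 * (x ^ (-(13 / 100 : ℝ)) * x ^ (4 : ℝ)) * ((r : ℝ) * r) := by
    rw [hq, show (4 : ℝ) = ((4 : ℕ) : ℝ) by norm_num, Real.rpow_natCast]; ring
  rw [e]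
  have hπ : (1 : ℝ) ≤ (4 * π ^ 2) ^ 2 := by
    have h1 : (1 : ℝ) ≤ 4 * π ^ 2 := by nlinarith [Real.pi_gt_three]
    nlinarith
  have hmono : x ^ (497 / 100 : ℝ) * (r : ℝ) ≤ (x ^ (-(13 / 100 : ℝ)) * x ^ (4 : ℝ)) * ((r : ℝ) * r) := by
    have e2 : x ^ (497 / 100 : ℝ) = (x ^ (-(13 / 100 : ℝ)) * x ^ (4 : ℝ)) * x ^ (11 / 10 : ℝ) := by
      rw [← Real.rpow_add hqh0, ← Real.rpow_add hqh0]; norm_num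
    rw [e2, mul_assoc]
    exact mul_le_mul_of_nonneg_left (mul_le_mul_of_nonneg_right hr.le hr0.le) (by positivity)
  calc x ^ (4 * Δ') * r ≤ x ^ (497 / 100 : ℝ) * r := mul_le_mul_of_nonneg_right hx4 hr0.le
    _ ≤ (x ^ (-(13 / 100 : ℝ)) * x ^ (4 : ℝ)) * ((r : ℝ) * r) := hmono
    _ = 1 * ((x ^ (-(13 / 100 : ℝ)) * x ^ (4 : ℝ)) * ((r : ℝ) * r)) := by ring
    _ ≤ (4 * π ^ 2) ^ 2 * ((x ^ (-(13 / 100 : ℝ)) * x ^ (4 : ℝ)) * ((r : ℝ) * r)) :=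
        mul_le_mul_of_nonneg_right hπ (by positivity)
    _ = _ := by ring

/-- `1/r ≤ x^{−13/100}` on the band. [folklore] -/
theorem generic_scalar_three_le {q : ℕ} [NeZero q] (h64 : 64 ≤ q) {r : ℕ} (hr : KMV2000.qhat q ^ (11 / 10 : ℝ) < r) :
    1 / (r : ℝ) ≤ KMV2000.qhat q ^ (-(13 / 100 : ℝ)) := by
  have hqh1 : 1 < KMV2000.qhat q := one_lt_qhat h64
  have hqh0 : 0 < KMV2000.qhat q := zero_lt_one.trans hqh1
  have hr0 : (0 : ℝ) < r := lt_trans (Real.rpow_pos_of_pos hqh0 _) hr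
  rw [div_le_iff₀ hr0]
  have h1 : (1 : ℝ) ≤ KMV2000.qhat q ^ (-(13 / 100 : ℝ)) * KMV2000.qhat q ^ (11 / 10 : ℝ) := by
    rw [← Real.rpow_add hqh0]
    exact Real.one_le_rpow hqh1.le (by norm_num)
  exact h1.trans (mul_le_mul_of_nonneg_left hr.le (Real.rpow_nonneg hqh0.le _))

/-- **The generic size of the class bracket**: for class data `g, d₁, d₂, s₂, t₁ ≥ 1` on the band,
`r t₁² x^{6Δ'} Y/(g²(d₁d₂)⁴s₂²(qr)³) + r t₁² x^{4Δ'}/(g(d₁d₂)²s₂²(qr)²) + g/r ≤ 3·t₁²·g·x^{−13/100}`. [folklore] -/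
theorem bracket71_generic_le {q : ℕ} [NeZero q] (h64 : 64 ≤ q) {Δ' η : ℝ} (hΔ' : Δ' ≤ 101 / 100)
    (hη0 : 0 ≤ η) (hη : η ≤ 1 / 100) {r : ℕ} (hr : KMV2000.qhat q ^ (11 / 10 : ℝ) < r)
    {g d₁ d₂ s₂ t₁ : ℕ} (hg : 1 ≤ g) (hd₁ : 1 ≤ d₁) (hd₂ : 1 ≤ d₂) (hs₂ : 1 ≤ s₂) (ht₁ : 1 ≤ t₁) :
    (r : ℝ) * (t₁ : ℝ) ^ 2 * KMV2000.qhat q ^ (6 * Δ') * ((⌈KMV2000.qhat q ^ (2 + η)⌉₊ : ℕ) : ℝ) /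
          ((g : ℝ) ^ 2 * ((d₁ : ℝ) * d₂) ^ 4 * (s₂ : ℝ) ^ 2 * ((q : ℝ) * r) ^ 3) +
        (r : ℝ) * (t₁ : ℝ) ^ 2 * KMV2000.qhat q ^ (4 * Δ') / ((g : ℝ) * ((d₁ : ℝ) * d₂) ^ 2 * (s₂ : ℝ) ^ 2 * ((q : ℝ) * r) ^ 2) +
        (g : ℝ) / r ≤
      3 * (t₁ : ℝ) ^ 2 * g * KMV2000.qhat q ^ (-(13 / 100 : ℝ)) := by
  have hqh1 : 1 < KMV2000.qhat q := one_lt_qhat h64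
  have hqh0 : 0 < KMV2000.qhat q := zero_lt_one.trans hqh1
  set x : ℝ := KMV2000.qhat q with hx
  have hr0 : (0 : ℝ) < r := lt_trans (Real.rpow_pos_of_pos hqh0 _) hr
  have hq : (q : ℝ) = 4 * π ^ 2 * x ^ 2 := by rw [hx]; exact natCast_eq_four_pi_sq_mul_qhat_sq q
  have hq0 : (0 : ℝ) < q := by rw [hq]; positivity
  have hqr : (0 : ℝ) < (q : ℝ) * r := by positivity
  have h1 := generic_scalar_one_le h64 hΔ' hη0 hη hr
  have h2 := generic_scalar_two_le h64 hΔ' hr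
  have h3 := generic_scalar_three_le h64 hr
  have hg1 : (1 : ℝ) ≤ g := by exact_mod_cast hg
  have ht1 : (1 : ℝ) ≤ t₁ := by exact_mod_cast ht₁
  have hD1 : (1 : ℝ) ≤ (g : ℝ) ^ 2 * ((d₁ : ℝ) * d₂) ^ 4 * (s₂ : ℝ) ^ 2 := by
    have : (1 : ℝ) ≤ d₁ := by exact_mod_cast hd₁
    have : (1 : ℝ) ≤ d₂ := by exact_mod_cast hd₂
    have : (1 : ℝ) ≤ s₂ := by exact_mod_cast hs₂
    have hdd : (1 : ℝ) ≤ (d₁ : ℝ) * d₂ := by nlinarith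
    calc (1 : ℝ) = 1 ^ 2 * 1 ^ 4 * 1 ^ 2 := by norm_num
      _ ≤ (g : ℝ) ^ 2 * ((d₁ : ℝ) * d₂) ^ 4 * (s₂ : ℝ) ^ 2 := by gcongr
  have hD2 : (1 : ℝ) ≤ (g : ℝ) * ((d₁ : ℝ) * d₂) ^ 2 * (s₂ : ℝ) ^ 2 := by
    have : (1 : ℝ) ≤ d₁ := by exact_mod_cast hd₁
    have : (1 : ℝ) ≤ d₂ := by exact_mod_cast hd₂
    have : (1 : ℝ) ≤ s₂ := by exact_mod_cast hs₂
    have hdd : (1 : ℝ) ≤ (d₁ : ℝ) * d₂ := by nlinarith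
    calc (1 : ℝ) = 1 * 1 ^ 2 * 1 ^ 2 := by norm_num
      _ ≤ (g : ℝ) * ((d₁ : ℝ) * d₂) ^ 2 * (s₂ : ℝ) ^ 2 := by gcongr
  set E : ℝ := x ^ (-(13 / 100 : ℝ)) with hE
  have hE0 : 0 < E := Real.rpow_pos_of_pos hqh0 _
  -- term 1
  have hT1 : (r : ℝ) * (t₁ : ℝ) ^ 2 * x ^ (6 * Δ') * ((⌈x ^ (2 + η)⌉₊ : ℕ) : ℝ) /
      ((g : ℝ) ^ 2 * ((d₁ : ℝ) * d₂) ^ 4 * (s₂ : ℝ) ^ 2 * ((q : ℝ) * r) ^ 3) ≤ (t₁ : ℝ) ^ 2 * g * E := by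
    calc _ ≤ (r : ℝ) * (t₁ : ℝ) ^ 2 * x ^ (6 * Δ') * ((⌈x ^ (2 + η)⌉₊ : ℕ) : ℝ) / (1 * ((q : ℝ) * r) ^ 3) := by
          refine div_le_div_of_nonneg_left (by positivity) (by positivity) ?_
          exact mul_le_mul_of_nonneg_right hD1 (by positivity)
      _ = (t₁ : ℝ) ^ 2 * (x ^ (6 * Δ') * ((⌈x ^ (2 + η)⌉₊ : ℕ) : ℝ) * r / ((q : ℝ) * r) ^ 3) := by ring
      _ ≤ (t₁ : ℝ) ^ 2 * E := mul_le_mul_of_nonneg_left h1 (by positivity)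
      _ = (t₁ : ℝ) ^ 2 * 1 * E := by ring
      _ ≤ (t₁ : ℝ) ^ 2 * g * E := by gcongr
  -- term 2
  have hT2 : (r : ℝ) * (t₁ : ℝ) ^ 2 * x ^ (4 * Δ') / ((g : ℝ) * ((d₁ : ℝ) * d₂) ^ 2 * (s₂ : ℝ) ^ 2 * ((q : ℝ) * r) ^ 2) ≤
      (t₁ : ℝ) ^ 2 * g * E := by
    calc _ ≤ (r : ℝ) * (t₁ : ℝ) ^ 2 * x ^ (4 * Δ') / (1 * ((q : ℝ) * r) ^ 2) := by
          refine div_le_div_of_nonneg_left (by positivity) (by positivity) ?_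
          exact mul_le_mul_of_nonneg_right hD2 (by positivity)
      _ = (t₁ : ℝ) ^ 2 * (x ^ (4 * Δ') * r / ((q : ℝ) * r) ^ 2) := by ring
      _ ≤ (t₁ : ℝ) ^ 2 * E := mul_le_mul_of_nonneg_left h2 (by positivity)
      _ = (t₁ : ℝ) ^ 2 * 1 * E := by ring
      _ ≤ (t₁ : ℝ) ^ 2 * g * E := by gcongr
  -- term 3
  have hT3 : (g : ℝ) / r ≤ (t₁ : ℝ) ^ 2 * g * E := by
    calc (g : ℝ) / r = g * (1 / (r : ℝ)) := by ring
      _ ≤ g * E := mul_le_mul_of_nonneg_left h3 (by positivity)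
      _ = 1 ^ 2 * g * E := by ring
      _ ≤ (t₁ : ℝ) ^ 2 * g * E := by gcongr
  linarith

end Summit.Parity.GeneralizedHardyLittlewood.Theorems.MomentsBeyondDiagonal.Layers

end
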